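import Literature.NumberTheory.LFunctions.WeilExplicitArchParitySech
import Literature.NumberTheory.LFunctions.WeilMarkovQuadratic
import Literature.NumberTheory.LFunctions.WeilArchimedeanMoments
import HarnessLib

/-!
# The analytic (frequency-side) form of Weil's twisted functional `Q_χ` on a finite-prime window

Topic `Literature/NumberTheory/LFunctions`; vocabulary of `WeilExplicit.lean` (tests `IsWeilTest` =
`C_c^∞`, transform `ĝ(s) = weilMellin g s = ∫ g(x) e^{(s-1/2)x} dx`, so `ĝ(1/2+iτ) = ∫ g e^{iτx}`,
kernel `k = g ⋆ g̃ = weilConv g (weilReflect g)`) and of `WeilExplicitDirichlet.lean` (Weil's (11) for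
`k = ℚ` and a Dirichlet character `χ` mod `q`: `W_χ = weilFunctionalChar χ`,
`Q_χ(g) = W_χ(g ⋆ g̃) = weilQuadraticChar χ g`, parity `a_χ = charParity χ`, rung predicate
`WeilPositivityOnChar χ t = ∀ g ∈ C_c^∞[-t, t], 0 ≤ Re Q_χ(g)`).  `χ`-twisted sibling of
`WeilFinitePrimeQuadratic.lean` (Yoshida's analytic form (2.1) for `ζ` with the finitely many prime
powers visible on the window).  Everything here is PROVED; there are no named facts.

**Theorem** (`weilQuadraticChar_eq_weilFinitePrimeQuadraticChar`,
`weilQuadraticChar_re_eq_weilFinitePrimeQuadraticChar`).  For `χ` mod `q ≠ 1` (any parity, imprimitive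
allowed), `e^{2t} ≤ N + 1` and a test function `g` with `tsupport g ⊆ [-t, t]`:

    `Q_χ(g) = E_{χ,N}(g) := (1/2π) ∫ |ĝ(1/2+iτ)|² M_{χ,N}(τ) dτ`,
    `M_{χ,N}(τ) = Re ψ(1/4 + a_χ/2 + iτ/2) + log q − log π
                   − Σ_{n ≤ N} (Λ(n)/√n) · 2 (Re χ(n) cos(τ log n) + Im χ(n) sin(τ log n))`

(`weilPrimeRippleChar`, `weilFinitePrimeWeightChar`, `weilFinitePrimeQuadraticChar`); in particular
`Im Q_χ(g) = 0`, and the rung at `t = (log (N+1))/2` is `∀ g, 0 ≤ E_{χ,N}(g)`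
(`weilPositivityOnChar_log_succ_half_iff`).  This is Weil's (11) at `F = g ⋆ g̃` read on the line
`Re s = 1/2`: by Mellin inversion at `± log n` (`weilMellin_inversion`, Bombieri §2) every twisted prime
spike is diagonal in frequency,
`χ(n) k(log n) + χ̄(n) k(−log n) = (1/2π) ∫ |ĝ(1/2+iτ)|² · 2 Re(χ(n) e^{−iτ log n}) dτ`
(`mul_weilConv_weilReflect_add_conj_mul_neg_eq_integral`); only `n ≤ N` enter because `k` is supported
in the open interval `(−2t, 2t)` (`weilPrimeTermChar_eq_sum_of_tsupport_subset`); the archimedean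
integral of parity `a` at `k` is `∫ |ĝ|² Re ψ(1/4 + a/2 + iτ/2)` (`weilArchIntegralChar_weilConv_weilReflect`),
and `k(0)(log q − log π) = ‖g‖₂²(log q − log π)` is folded into the weight by Plancherel
(`integral_norm_sq_weilMellin_half_line`).  The weight `M_{χ,N}` is, symbol for symbol, the multiplier
`M(τ)` of the GRH arm's dual (format-D) certificates (cell `rh-explicit`; the soundness of those
certificates over this form lives in `Summits/Ventures/WeilGRH/`).

## References

* A. Weil, *Sur les "formules explicites" de la théorie des nombres premiers*, Comm. Sém. Math. Univ.
  Lund, tome suppl. (1952), 252–265 — (11) pp. 261–262 (explicit formula with characters, `k = ℚ`),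
  (5), (10) pp. 254, 258 (digamma form of the archimedean term), the «lemme» p. 262.
* H. Yoshida, *On Hermitian forms attached to zeta functions*, Adv. Stud. Pure Math. 21 (1992),
  281–325 — §2 eq. (2.1) (analytic form on a window), Thm 1.
* E. Bombieri, *Remarks on Weil's quadratic functional in the theory of prime numbers I*, Rend. Mat.
  Acc. Lincei (9) 11 (2000), 183–233 — §2 (Mellin inversion on vertical lines).
-/

noncomputable section

open Complex Filter Set MeasureTheory
open scoped Real Topology ArithmeticFunction.vonMangoldt ComplexConjugate

namespace Literature.NumberTheory.LFunctions

variable {q : ℕ} {g : ℝ → ℂ}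

/-! ## Every twisted prime spike is diagonal in frequency -/

/-- Mellin inversion on the critical line for the kernel `k = g ⋆ g̃` at ONE point `x`:
`2π k(x) = ∫ |ĝ(1/2+iτ)|² e^{-iτx} dτ`. [cite: Bombieri2000Weil, §2 (inverse Mellin transform) applied to g ⋆ g̃] -/
theorem weilConv_weilReflect_eq_integral_exp (hg : IsWeilTest g) (x : ℝ) :
    2 * π * weilConv g (weilReflect g) x =
      ∫ τ : ℝ, ((‖weilMellin g (1 / 2 + τ * I)‖ ^ 2 : ℝ) : ℂ) * cexp (-(τ * I) * x) := by
  have hk : IsWeilTest (weilConv g (weilReflect g)) := hg.weilConv hg.weilReflect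
  have h1 := weilMellin_inversion hk (1 / 2) x
  have e0 : ((1 / 2 : ℝ) : ℂ) - 1 / 2 = 0 := by push_cast; ring
  simp only [e0, zero_mul, Complex.exp_zero, mul_one] at h1
  rw [← h1]
  congr 1 with τ
  have ht : ((1 / 2 : ℝ) : ℂ) + τ * I = 1 / 2 + τ * I := by push_cast; ring
  rw [ht, weilMellin_weilConv_weilReflect_half hg τ]

/-- The **twisted spike in frequency**: for any complex number `ω` (a character value),
`ω k(x) + ω̄ k(−x) = (1/2π) ∫ |ĝ(1/2+iτ)|² · 2(Re ω cos(τx) + Im ω sin(τx)) dτ`, `k = g ⋆ g̃`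
(Mellin inversion at `x` and `−x`; `ω e^{-iτx} + ω̄ e^{iτx} = 2 Re(ω e^{-iτx})`).
[cite: Bombieri2000Weil, §2 (inverse Mellin transform on Re s = 1/2) applied to g ⋆ g̃ at ± x; Weil1952FormulesExplicites, (11) pp. 261–262 (the summand χ(𝔭)ⁿF(log N𝔭ⁿ) + χ(𝔭)⁻ⁿF(−log N𝔭ⁿ))] -/
theorem mul_weilConv_weilReflect_add_conj_mul_neg_eq_integral (hg : IsWeilTest g) (ω : ℂ) (x : ℝ) :
    ω * weilConv g (weilReflect g) x + conj ω * weilConv g (weilReflect g) (-x) =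
      (1 / (2 * π) : ℂ) * ((∫ τ : ℝ, ‖weilMellin g (1 / 2 + τ * I)‖ ^ 2 *
        (2 * (ω.re * Real.cos (τ * x) + ω.im * Real.sin (τ * x))) : ℝ) : ℂ) := by
  have hk : IsWeilTest (weilConv g (weilReflect g)) := hg.weilConv hg.weilReflect
  -- integrability of the two one-sided spike integrands
  have hb : ∀ (y : ℝ) (τ : ℝ), ‖cexp (-(τ * I) * y)‖ ≤ 1 := fun y τ ↦ by
    rw [show -(τ * I : ℂ) * (y : ℝ) = ((-(τ * y) : ℝ) : ℂ) * I by push_cast; ring,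
      Complex.norm_exp_ofReal_mul_I]
  have hi : ∀ y : ℝ, Integrable fun τ : ℝ ↦
      ((‖weilMellin g (1 / 2 + τ * I)‖ ^ 2 : ℝ) : ℂ) * cexp (-(τ * I) * y) := by
    intro y
    have h := integrable_weilMellin_vertical_mul hk (1 / 2) (F := fun τ : ℝ ↦ cexp (-(τ * I) * y))
      (by fun_prop) (hb y)
    refine h.congr (Eventually.of_forall fun τ ↦ ?_)
    simp only
    have ht : ((1 / 2 : ℝ) : ℂ) + τ * I = 1 / 2 + τ * I := by push_cast; ring
    rw [ht, weilMellin_weilConv_weilReflect_half hg τ]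
  have hpi : (2 * π : ℂ) ≠ 0 := by
    have : (0 : ℝ) < 2 * π := by positivity
    exact_mod_cast this.ne'
  have h1 := weilConv_weilReflect_eq_integral_exp hg x
  have h2 := weilConv_weilReflect_eq_integral_exp hg (-x)
  have key : 2 * π * (ω * weilConv g (weilReflect g) x + conj ω * weilConv g (weilReflect g) (-x)) =
      ((∫ τ : ℝ, ‖weilMellin g (1 / 2 + τ * I)‖ ^ 2 *
        (2 * (ω.re * Real.cos (τ * x) + ω.im * Real.sin (τ * x))) : ℝ) : ℂ) := by
    calc 2 * π * (ω * weilConv g (weilReflect g) x + conj ω * weilConv g (weilReflect g) (-x))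
        = ω * (2 * π * weilConv g (weilReflect g) x) +
            conj ω * (2 * π * weilConv g (weilReflect g) (-x)) := by ring
      _ = ω * (∫ τ : ℝ, ((‖weilMellin g (1 / 2 + τ * I)‖ ^ 2 : ℝ) : ℂ) * cexp (-(τ * I) * x)) +
            conj ω * (∫ τ : ℝ, ((‖weilMellin g (1 / 2 + τ * I)‖ ^ 2 : ℝ) : ℂ) *
              cexp (-(τ * I) * ((-x : ℝ) : ℂ))) := by rw [h1, h2]
      _ = ∫ τ : ℝ, (ω * (((‖weilMellin g (1 / 2 + τ * I)‖ ^ 2 : ℝ) : ℂ) * cexp (-(τ * I) * x)) +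
            conj ω * (((‖weilMellin g (1 / 2 + τ * I)‖ ^ 2 : ℝ) : ℂ) *
              cexp (-(τ * I) * ((-x : ℝ) : ℂ)))) := by
          rw [integral_add ((hi x).const_mul ω) ((hi (-x)).const_mul _), integral_const_mul,
            integral_const_mul]
      _ = ((∫ τ : ℝ, ‖weilMellin g (1 / 2 + τ * I)‖ ^ 2 *
            (2 * (ω.re * Real.cos (τ * x) + ω.im * Real.sin (τ * x))) : ℝ) : ℂ) := by
          rw [← integral_complex_ofReal]
          congr 1 with τ
          have e1 : -(τ * I : ℂ) * (x : ℝ) = ((-(τ * x) : ℝ) : ℂ) * I := by push_cast; ring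
          have e2 : -(τ * I : ℂ) * ((-x : ℝ) : ℂ) = ((τ * x : ℝ) : ℂ) * I := by push_cast; ring
          rw [e1, e2, Complex.exp_ofReal_mul_I, Complex.exp_ofReal_mul_I]
          apply Complex.ext
          · simp [Real.cos_neg, Real.sin_neg]
            ring
          · simp [Real.cos_neg, Real.sin_neg]
            ring
  rw [← key]
  field_simp

/-! ## The twisted ripple, the finite-prime weight `M_{χ,N}` and the analytic form `E_{χ,N}` -/

/-- The **twisted prime ripple** `ρ_{χ,N}(τ) = Σ_{n ≤ N} (Λ(n)/√n) · 2(Re χ(n) cos(τ log n) + Im χ(n) sin(τ log n))`: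
the frequency-side image of the twisted prime spikes `(Λ(n)/√n)(χ(n) δ_{log n} + χ̄(n) δ_{−log n})`,
`n ≤ N` (`2 Re(χ(n) e^{−iτ log n})`; for `χ(n) = 0`, i.e. `(n, q) > 1`, the term is `0`).
[cite: Weil1952FormulesExplicites, (11) pp. 261–262 (prime term), read on the line Re s = 1/2] -/
def weilPrimeRippleChar (χ : DirichletCharacter ℂ q) (N : ℕ) (τ : ℝ) : ℝ :=
  ∑ n ∈ Finset.range (N + 1), (Λ n : ℝ) / Real.sqrt n *
    (2 * ((χ (n : ZMod q)).re * Real.cos (τ * Real.log n) +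
      (χ (n : ZMod q)).im * Real.sin (τ * Real.log n)))

/-- The **twisted finite-prime Weil weight** on the window where only `n ≤ N` enter:
`M_{χ,N}(τ) = Re ψ(1/4 + a_χ/2 + iτ/2) + (log q − log π) − ρ_{χ,N}(τ)`, `a_χ = charParity χ` — the
`χ`-analogue of the `ζ`-side `weilFinitePrimeWeight N` (`Re ψ(1/4 + iτ/2) − ρ_N`), with the parity in
the digamma argument and the conductor constant `log q − log π` folded in (there is no polar term).
[cite: Weil1952FormulesExplicites, (11) pp. 261–262 with (5), (10) pp. 254, 258 (digamma form of the archimedean term); Yoshida1992, §2 eq. (2.1) (shape)] -/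
def weilFinitePrimeWeightChar (χ : DirichletCharacter ℂ q) (N : ℕ) (τ : ℝ) : ℝ :=
  (Complex.digamma (1 / 4 + (charParity χ : ℂ) / 2 + τ / 2 * I)).re + (Real.log q - Real.log π) -
    weilPrimeRippleChar χ N τ

/-- The **twisted finite-prime analytic form** `E_{χ,N}(g) = (1/2π) ∫ |ĝ(1/2+iτ)|² M_{χ,N}(τ) dτ`
(the `χ`-analogue of the `ζ`-side `weilFinitePrimeQuadratic N g`; polar term absent, `(log q − log π)‖g‖₂²`
inside the weight by Plancherel). [cite: Weil1952FormulesExplicites, (11) pp. 261–262 at F = g ⋆ g̃ on Re s = 1/2; Yoshida1992, §2 eq. (2.1) (shape)] -/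
def weilFinitePrimeQuadraticChar (χ : DirichletCharacter ℂ q) (N : ℕ) (g : ℝ → ℂ) : ℝ :=
  1 / (2 * π) * ∫ τ : ℝ, ‖weilMellin g (1 / 2 + τ * I)‖ ^ 2 * weilFinitePrimeWeightChar χ N τ

/-- `τ ↦ |ĝ(1/2+iτ)|² ρ_{χ,N}(τ)` is integrable, and its integral is the finite sum of the spike
integrals. [cite: Weil1952FormulesExplicites, (11) pp. 261–262 (prime term, finitely many n ≤ N, read on Re s = 1/2)] -/
theorem integral_norm_sq_weilMellin_mul_weilPrimeRippleChar (hg : IsWeilTest g)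
    (χ : DirichletCharacter ℂ q) (N : ℕ) :
    Integrable (fun τ : ℝ ↦ ‖weilMellin g (1 / 2 + τ * I)‖ ^ 2 * weilPrimeRippleChar χ N τ) ∧
      ∫ τ : ℝ, ‖weilMellin g (1 / 2 + τ * I)‖ ^ 2 * weilPrimeRippleChar χ N τ =
        ∑ n ∈ Finset.range (N + 1), (Λ n : ℝ) / Real.sqrt n *
          ∫ τ : ℝ, ‖weilMellin g (1 / 2 + τ * I)‖ ^ 2 *
            (2 * ((χ (n : ZMod q)).re * Real.cos (τ * Real.log n) +
              (χ (n : ZMod q)).im * Real.sin (τ * Real.log n))) := by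
  have e : (fun τ : ℝ ↦ ‖weilMellin g (1 / 2 + τ * I)‖ ^ 2 * weilPrimeRippleChar χ N τ) =
      fun τ : ℝ ↦ ∑ n ∈ Finset.range (N + 1), (Λ n : ℝ) / Real.sqrt n *
        (‖weilMellin g (1 / 2 + τ * I)‖ ^ 2 *
          (2 * ((χ (n : ZMod q)).re * Real.cos (τ * Real.log n) +
            (χ (n : ZMod q)).im * Real.sin (τ * Real.log n)))) := by
    funext τ
    unfold weilPrimeRippleChar
    rw [Finset.mul_sum]
    exact Finset.sum_congr rfl fun n _ ↦ by ring
  have hI : ∀ n ∈ Finset.range (N + 1), Integrable fun τ : ℝ ↦ (Λ n : ℝ) / Real.sqrt n *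
      (‖weilMellin g (1 / 2 + τ * I)‖ ^ 2 *
        (2 * ((χ (n : ZMod q)).re * Real.cos (τ * Real.log n) +
          (χ (n : ZMod q)).im * Real.sin (τ * Real.log n)))) := by
    intro n _
    refine Integrable.const_mul ?_ _
    refine integrable_norm_sq_weilMellin_mul hg (by fun_prop)
      (A := 2 * (|(χ (n : ZMod q)).re| + |(χ (n : ZMod q)).im|)) (B := 0) (by positivity) le_rfl
      fun τ ↦ ?_
    rw [zero_mul, add_zero, abs_mul, abs_of_pos (by norm_num : (0 : ℝ) < 2)]
    refine mul_le_mul_of_nonneg_left ((abs_add_le _ _).trans (add_le_add ?_ ?_)) (by norm_num)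
    · rw [abs_mul]
      exact (mul_le_mul_of_nonneg_left (Real.abs_cos_le_one _) (abs_nonneg _)).trans (by simp)
    · rw [abs_mul]
      exact (mul_le_mul_of_nonneg_left (Real.abs_sin_le_one _) (abs_nonneg _)).trans (by simp)
  rw [e]
  refine ⟨integrable_finsetSum _ hI, ?_⟩
  rw [integral_finsetSum _ hI]
  exact Finset.sum_congr rfl fun n _ ↦ integral_const_mul _ _

open Literature.Analysis.SpecialFunctions.Complex in
/-- Integrability of the parity-shifted archimedean integrand `|ĝ(1/2+iτ)|² Re ψ(x + iτ/2)` for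
`x > 0` (decay of `(g ⋆ g̃)^ = |ĝ|²` against the logarithmic growth of `ψ`:
`WeilArchParity.integrable_weilMellin_mul_re_digamma_shift` at `k = g ⋆ g̃`).
[cite: Bombieri2000Weil, §2 (convergence of the Gamma-factor integral against the transform on Re s = 1/2)] -/
theorem integrable_norm_sq_weilMellin_mul_re_digamma (hg : IsWeilTest g) {x : ℝ} (hx : 0 < x) :
    Integrable fun τ : ℝ ↦ ‖weilMellin g (1 / 2 + τ * I)‖ ^ 2 *
      (Complex.digamma (x + τ / 2 * I)).re := by
  have hk : IsWeilTest (weilConv g (weilReflect g)) := hg.weilConv hg.weilReflect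
  have h := (WeilArchParity.integrable_weilMellin_mul_re_digamma_shift hk hx).re
  refine h.congr (Eventually.of_forall fun τ ↦ ?_)
  simp only [RCLike.re_to_complex]
  rw [weilMellin_weilConv_weilReflect_half hg τ, ← Complex.ofReal_mul, Complex.ofReal_re]

/-- The digamma argument of `weilArchIntegralChar a`: `1/4 + a/2 + iτ/2 = x + iτ/2` with the REAL
`x = 1/4 + a/2 > 0`. [folklore] -/
private theorem weilArchChar_digamma_arg (a : ℕ) (τ : ℝ) :
    (1 / 4 + (a : ℂ) / 2 + τ / 2 * I : ℂ) = ((1 / 4 + (a : ℝ) / 2 : ℝ) : ℂ) + τ / 2 * I := by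
  push_cast; ring

/-- `τ ↦ |ĝ(1/2+iτ)|² M_{χ,N}(τ)` is integrable (the integral `E_{χ,N}(g)` converges absolutely).
[cite: Weil1952FormulesExplicites, (11) pp. 261–262 at F = g ⋆ g̃ on Re s = 1/2 (absolute convergence of each term)] -/
theorem integrable_norm_sq_weilMellin_mul_weilFinitePrimeWeightChar (hg : IsWeilTest g)
    (χ : DirichletCharacter ℂ q) (N : ℕ) :
    Integrable fun τ : ℝ ↦ ‖weilMellin g (1 / 2 + τ * I)‖ ^ 2 * weilFinitePrimeWeightChar χ N τ := by
  have hx : (0 : ℝ) < 1 / 4 + (charParity χ : ℝ) / 2 := by positivity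
  have h1 := integrable_norm_sq_weilMellin_mul_re_digamma hg hx
  have h2 := (integrable_norm_sq_weilMellin_half_line hg).mul_const (Real.log q - Real.log π)
  have h3 := (integral_norm_sq_weilMellin_mul_weilPrimeRippleChar hg χ N).1
  refine ((h1.add h2).sub h3).congr (Eventually.of_forall fun τ ↦ ?_)
  simp only [Pi.add_apply, Pi.sub_apply]
  unfold weilFinitePrimeWeightChar
  rw [weilArchChar_digamma_arg]
  ring

/-- The archimedean integral of parity `a` at `g ⋆ g̃` is the real number
`∫ |ĝ(1/2+iτ)|² Re ψ(1/4 + a/2 + iτ/2) dτ`. [cite: Weil1952FormulesExplicites, (11) with (5), (10) (archimedean term on Re s = 1/2)] -/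
theorem weilArchIntegralChar_weilConv_weilReflect (hg : IsWeilTest g) (a : ℕ) :
    weilArchIntegralChar a (weilConv g (weilReflect g)) =
      ((∫ τ : ℝ, ‖weilMellin g (1 / 2 + τ * I)‖ ^ 2 *
        (Complex.digamma (1 / 4 + (a : ℂ) / 2 + τ / 2 * I)).re : ℝ) : ℂ) := by
  unfold weilArchIntegralChar
  rw [← integral_complex_ofReal]
  congr 1 with τ
  rw [weilMellin_weilConv_weilReflect_half hg τ]
  push_cast
  ring

/-- For a continuous `k` with `tsupport k ⊆ [-2t, 2t]` and `e^{2t} ≤ N + 1` the twisted prime term is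
the FINITE sum over `n ≤ N` (`k(± log n) = 0` for `n ≥ N + 1`, the support being open inside the
closed window). [cite: Weil1952FormulesExplicites, (11) pp. 261–262 (prime term) restricted to supp ⊆ [−2t, 2t]] -/
theorem weilPrimeTermChar_eq_sum_of_tsupport_subset (χ : DirichletCharacter ℂ q) {k : ℝ → ℂ}
    (hk : Continuous k) {t : ℝ} {N : ℕ} (hN : Real.exp (2 * t) ≤ (N : ℝ) + 1)
    (hsupp : tsupport k ⊆ Icc (-(2 * t)) (2 * t)) :
    weilPrimeTermChar χ k =
      ∑ n ∈ Finset.range (N + 1), ((Λ n : ℝ) : ℂ) / (Real.sqrt n : ℂ) *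
        (χ (n : ZMod q) * k (Real.log n) + conj (χ (n : ZMod q)) * k (-Real.log n)) := by
  have hIoo : Function.support k ⊆ Ioo (-(2 * t)) (2 * t) :=
    support_subset_Ioo_of_tsupport_subset_Icc hk hsupp
  have hzero : ∀ x : ℝ, 2 * t ≤ |x| → k x = 0 := by
    intro x hx
    by_contra hne
    have hmem := hIoo (Function.mem_support.2 hne)
    rw [mem_Ioo] at hmem
    have : |x| < 2 * t := abs_lt.2 ⟨hmem.1, hmem.2⟩
    linarith
  have hfin : ∀ n ∉ Finset.range (N + 1),
      ((Λ n : ℝ) : ℂ) / (Real.sqrt n : ℂ) *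
        (χ (n : ZMod q) * k (Real.log n) + conj (χ (n : ZMod q)) * k (-Real.log n)) = 0 := by
    intro n hn
    rw [Finset.mem_range, not_lt] at hn
    have hn' : (N : ℝ) + 1 ≤ n := by exact_mod_cast hn
    have hnpos : (0 : ℝ) < n := by linarith
    have hlog : 2 * t ≤ Real.log n := by
      rw [Real.le_log_iff_exp_le hnpos]
      exact hN.trans hn'
    have hpos : 0 ≤ Real.log n := Real.log_natCast_nonneg n
    rw [hzero _ (by rwa [abs_of_nonneg hpos]), hzero _ (by rwa [abs_neg, abs_of_nonneg hpos])]
    simp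
  unfold weilPrimeTermChar
  exact tsum_eq_sum hfin

/-- **`Q_χ(g)` in analytic (frequency-side) form on a finite-prime window.** For a Dirichlet
character `χ` mod `q ≠ 1` (any parity, imprimitive allowed), `e^{2t} ≤ N + 1` and a test function `g`
with `tsupport g ⊆ [-t, t]`:
`W_χ(g ⋆ g̃) = (1/2π) ∫ |ĝ(1/2+iτ)|² M_{χ,N}(τ) dτ` as a complex number — prime terms
`Σ_{n ≤ N} (Λ(n)/√n)(χ(n)k(log n) + χ̄(n)k(−log n)) = (1/2π)∫|ĝ|² ρ_{χ,N}`, archimedean term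
`(1/2π)∫|ĝ|² Re ψ(1/4 + a_χ/2 + iτ/2) + (log q − log π)‖g‖₂²` with `‖g‖₂² = (1/2π)∫|ĝ|²` (Plancherel),
no polar term. (The `χ`-twisted form of Yoshida's (2.1); the normalisation `(M)` of the GRH arm.)
[cite: Weil1952FormulesExplicites, (11) pp. 261–262, k = ℚ, at F = g ⋆ g̃ on Re s = 1/2; Yoshida1992, §2 eq. (2.1) (shape)] -/
theorem weilQuadraticChar_eq_weilFinitePrimeQuadraticChar (hq : q ≠ 1) (χ : DirichletCharacter ℂ q)
    (hg : IsWeilTest g) {t : ℝ} {N : ℕ} (hN : Real.exp (2 * t) ≤ (N : ℝ) + 1)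
    (hsupp : tsupport g ⊆ Icc (-t) t) :
    weilQuadraticChar χ g = (weilFinitePrimeQuadraticChar χ N g : ℂ) := by
  have hk : IsWeilTest (weilConv g (weilReflect g)) := hg.weilConv hg.weilReflect
  have hks : tsupport (weilConv g (weilReflect g)) ⊆ Icc (-(2 * t)) (2 * t) :=
    tsupport_weilConv_weilReflect_subset hg.2 hsupp
  -- the spikes as frequency integrals
  set S : ℂ := ∑ n ∈ Finset.range (N + 1), ((Λ n : ℝ) : ℂ) / (Real.sqrt n : ℂ) *
      ((∫ τ : ℝ, ‖weilMellin g (1 / 2 + τ * I)‖ ^ 2 *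
        (2 * ((χ (n : ZMod q)).re * Real.cos (τ * Real.log n) +
          (χ (n : ZMod q)).im * Real.sin (τ * Real.log n))) : ℝ) : ℂ) with hS
  have hprime : weilPrimeTermChar χ (weilConv g (weilReflect g)) = (1 / (2 * π) : ℂ) * S := by
    rw [weilPrimeTermChar_eq_sum_of_tsupport_subset χ hk.1.continuous hN hks, hS, Finset.mul_sum]
    refine Finset.sum_congr rfl fun n _ ↦ ?_
    rw [mul_weilConv_weilReflect_add_conj_mul_neg_eq_integral hg]
    ring
  have hrip : (((∫ τ : ℝ, ‖weilMellin g (1 / 2 + τ * I)‖ ^ 2 * weilPrimeRippleChar χ N τ) : ℝ) : ℂ) =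
      S := by
    rw [(integral_norm_sq_weilMellin_mul_weilPrimeRippleChar hg χ N).2, hS]
    push_cast
    rfl
  have hx : (0 : ℝ) < 1 / 4 + (charParity χ : ℝ) / 2 := by positivity
  have hdig := integrable_norm_sq_weilMellin_mul_re_digamma hg hx
  have hdig' : Integrable fun τ : ℝ ↦ ‖weilMellin g (1 / 2 + τ * I)‖ ^ 2 *
      (Complex.digamma (1 / 4 + (charParity χ : ℂ) / 2 + τ / 2 * I)).re := by
    refine hdig.congr (Eventually.of_forall fun τ ↦ ?_)
    simp only
    rw [weilArchChar_digamma_arg]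
  have hsplit : ∫ τ : ℝ, ‖weilMellin g (1 / 2 + τ * I)‖ ^ 2 * weilFinitePrimeWeightChar χ N τ =
      (∫ τ : ℝ, ‖weilMellin g (1 / 2 + τ * I)‖ ^ 2 *
          (Complex.digamma (1 / 4 + (charParity χ : ℂ) / 2 + τ / 2 * I)).re) +
        (Real.log q - Real.log π) * (2 * π * weilNorm2Sq g) -
        ∫ τ : ℝ, ‖weilMellin g (1 / 2 + τ * I)‖ ^ 2 * weilPrimeRippleChar χ N τ := by
    have e : (fun τ : ℝ ↦ ‖weilMellin g (1 / 2 + τ * I)‖ ^ 2 * weilFinitePrimeWeightChar χ N τ) =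
        fun τ : ℝ ↦ ‖weilMellin g (1 / 2 + τ * I)‖ ^ 2 *
            (Complex.digamma (1 / 4 + (charParity χ : ℂ) / 2 + τ / 2 * I)).re +
          ‖weilMellin g (1 / 2 + τ * I)‖ ^ 2 * (Real.log q - Real.log π) -
          ‖weilMellin g (1 / 2 + τ * I)‖ ^ 2 * weilPrimeRippleChar χ N τ := by
      funext τ; unfold weilFinitePrimeWeightChar; ring
    have h2 : Integrable fun τ : ℝ ↦ ‖weilMellin g (1 / 2 + τ * I)‖ ^ 2 * (Real.log q - Real.log π) :=
      (integrable_norm_sq_weilMellin_half_line hg).mul_const _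
    have h12 : Integrable fun τ : ℝ ↦ ‖weilMellin g (1 / 2 + τ * I)‖ ^ 2 *
        (Complex.digamma (1 / 4 + (charParity χ : ℂ) / 2 + τ / 2 * I)).re +
          ‖weilMellin g (1 / 2 + τ * I)‖ ^ 2 * (Real.log q - Real.log π) := hdig'.add h2
    rw [e, integral_sub h12 (integral_norm_sq_weilMellin_mul_weilPrimeRippleChar hg χ N).1,
      integral_add hdig' h2, integral_mul_const, integral_norm_sq_weilMellin_half_line hg]
    ring
  unfold weilQuadraticChar weilFunctionalChar weilArchTermChar weilFinitePrimeQuadraticChar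
  rw [if_neg hq, hprime, weilArchIntegralChar_weilConv_weilReflect hg, weilConv_weilReflect_apply_zero,
    hsplit, ← hrip]
  unfold weilNorm2Sq
  set A : ℝ := ∫ τ : ℝ, ‖weilMellin g (1 / 2 + τ * I)‖ ^ 2 *
    (Complex.digamma (1 / 4 + (charParity χ : ℂ) / 2 + τ / 2 * I)).re
  set R : ℝ := ∫ τ : ℝ, ‖weilMellin g (1 / 2 + τ * I)‖ ^ 2 * weilPrimeRippleChar χ N τ
  set G : ℝ := ∫ t : ℝ, ‖g t‖ ^ 2
  have hπ : (π : ℂ) ≠ 0 := Complex.ofReal_ne_zero.2 Real.pi_ne_zero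
  push_cast
  field_simp
  ring

/-- Real-part version: `Re Q_χ(g) = E_{χ,N}(g) = (1/2π) ∫ |ĝ(1/2+iτ)|² M_{χ,N}(τ) dτ` on the window
`tsupport g ⊆ [-t, t]`, `e^{2t} ≤ N + 1`. [cite: Weil1952FormulesExplicites, (11) pp. 261–262 at F = g ⋆ g̃ on Re s = 1/2; Yoshida1992, §2 eq. (2.1) (shape)] -/
theorem weilQuadraticChar_re_eq_weilFinitePrimeQuadraticChar (hq : q ≠ 1) (χ : DirichletCharacter ℂ q)
    (hg : IsWeilTest g) {t : ℝ} {N : ℕ} (hN : Real.exp (2 * t) ≤ (N : ℝ) + 1)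
    (hsupp : tsupport g ⊆ Icc (-t) t) :
    (weilQuadraticChar χ g).re = weilFinitePrimeQuadraticChar χ N g := by
  rw [weilQuadraticChar_eq_weilFinitePrimeQuadraticChar hq χ hg hN hsupp, Complex.ofReal_re]

/-- On every window the twisted quadratic functional is real: `Im Q_χ(g) = 0` (`χ` mod `q ≠ 1`, any
parity; Weil's hermitian symmetry of (11) at `F = g ⋆ g̃`). [cite: Weil1952FormulesExplicites, the «lemme» p. 262 («la valeur commune des deux membres de (11)» is real at F = F₀ * F̃₀)] -/
theorem weilQuadraticChar_im_eq_zero_of_tsupport_subset (hq : q ≠ 1) (χ : DirichletCharacter ℂ q)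
    (hg : IsWeilTest g) {t : ℝ} (hsupp : tsupport g ⊆ Icc (-t) t) :
    (weilQuadraticChar χ g).im = 0 := by
  obtain ⟨N, hN⟩ := exists_nat_ge (Real.exp (2 * t))
  rw [weilQuadraticChar_eq_weilFinitePrimeQuadraticChar hq χ hg (N := N) (hN.trans (by linarith)) hsupp,
    Complex.ofReal_im]


/-- **Reduction of a rung of the GRH arm to its analytic form**: for `χ` mod `q ≠ 1`,
`WeilPositivityOnChar χ ((log (N+1))/2) ↔ ∀ g ∈ C_c^∞[−(log (N+1))/2, (log (N+1))/2], 0 ≤ E_{χ,N}(g)`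
(the `χ`-analogue of `weilPositivityOn_log_succ_half_iff`). [cite: Yoshida1992, Thm 1 shape (§6) with the p^m-terms, p^m ≤ N; Weil1952FormulesExplicites, the «lemme» p. 262] -/
theorem weilPositivityOnChar_log_succ_half_iff (hq : q ≠ 1) (χ : DirichletCharacter ℂ q) (N : ℕ) :
    WeilPositivityOnChar χ (Real.log ((N : ℝ) + 1) / 2) ↔
      ∀ g : ℝ → ℂ, IsWeilTest g →
        tsupport g ⊆ Icc (-(Real.log ((N : ℝ) + 1) / 2)) (Real.log ((N : ℝ) + 1) / 2) →
        0 ≤ weilFinitePrimeQuadraticChar χ N g := by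
  have hN : Real.exp (2 * (Real.log ((N : ℝ) + 1) / 2)) ≤ (N : ℝ) + 1 := by
    rw [show 2 * (Real.log ((N : ℝ) + 1) / 2) = Real.log ((N : ℝ) + 1) by ring,
      Real.exp_log (by positivity)]
  unfold WeilPositivityOnChar
  refine forall₃_congr fun g hg hsupp ↦ ?_
  rw [weilQuadraticChar_re_eq_weilFinitePrimeQuadraticChar hq χ hg hN hsupp]

end Literature.NumberTheory.LFunctions

end
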